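import Summits.ValiantsHypothesis.ValiantsHypothesis.Theorems.KPlusLogSqLawValuativeDoorTwoFourCalibration

/-!
# LINE `valuative_door` (crux `WeakLifting`, stmt-ValiantsHypothesis-19561) — NESTED PAIRS ARE NEVER BOTH DOMINANT:
# for four letters `a, b, c, e` of a symmetric `2 × 2` Sidon pencil with `d_a < d_b < d_c < d_e`, the exponents `d_a + d_e` and `d_b + d_c`
# are not both dominant

HONEST FRAMING.  Helper (cell `pub-symmetroid`, seat val-sym-lift-p1 g23, 2026-08-29; `--supports 19561 --as helper`).  The four-letter Gram
obstruction behind `…TwoFourCalibration` (crit-6 g4's anti-Monge argument, VERDICT #54 (g)) sharpened from «ten dominant exponents are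
impossible» to «the two NESTED pair exponents are not both dominant» (`not_nested_dominant_of_sidon`).  Proof: let `Λ_B`, `Λ_C` be the
dominance lines of `B = d_a + d_e` and `C = d_b + d_c` (`…RankOneExpansion.exists_dominant_iff_exists_slope`); the ROOF `h = min (Λ_B, Λ_C)` is
concave (`min_affine_outer_le_inner`), majorises `log v` on the support STRICTLY off `{B, C}` and touches it at `B` and `C`; on a Sidon support
the Gram entries `β(S_i, S_j)` of the four letters are the coefficients (`…SidonK` lemmas), so every Leibniz term of the singular `4 × 4` Gram
determinant (`det_gram_polarDet_eq_zero`) other than the reversal `(a e)(b c)` has `log v <` its roof sum `≤` (WEAK anti-Monge rearrangement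
`sum_perm_le_sum_rev`, the `≤` twin of `…TwoFourAntiMonge.sum_perm_lt_sum_rev` with separate row/column slopes, reusable on non-principal minors) the reversal's roof sum `= 2 log v(f_B) + 2 log v(f_C)` = the
reversal term: a unique `v`-largest term of a vanishing sum — contradiction.  Consequence (sequel `…ValuativeDoorSidonTwo`): the dominant
off-diagonal pairs form a chain, so `npEdges ≤ 3K − 4` at `m = 2` on Sidon supports.  Calibration only; no bearing on vW / vB, `TropicalB`,
`MatrixDescartes` (18050) or VP ≠ VNP.  [elementary]
-/

set_option linter.dupNamespace false
set_option autoImplicit false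

namespace Summit.ValiantsHypothesis.ValiantsHypothesis.Theorems.KPlusLogSqLaw.ValDoor

open Polynomial Finset Matrix
open scoped BigOperators Classical

variable {F : Type*} [Field F]

/-! ## §1 Coefficients on a Sidon support (`K` letters) -/

/-- on a SIDON support the off-diagonal coefficient at `d_i + d_j` is the polarised determinant `G_{ij} = a_i c_j + a_j c_i − 2 b_i b_j`
(`K`-letter form of `coeff_offdiag_of_sidon`). [bookkeeping] -/
theorem coeff_offdiag_of_sidonK {K : ℕ} (d : Fin K → ℕ) (S : Fin K → Matrix (Fin 2) (Fin 2) F) (hS : ∀ l, (S l).IsSymm)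
    (hsid : ∀ l₁ l₂ l₃ l₄ : Fin K, d l₁ + d l₂ = d l₃ + d l₄ → (l₁ = l₃ ∧ l₂ = l₄) ∨ (l₁ = l₄ ∧ l₂ = l₃))
    {i j : Fin K} (hij : i ≠ j) :
    (Matrix.det (∑ l, ((X : F[X]) ^ d l) • (S l).map (C : F →+* F[X]))).coeff (d i + d j)
      = S i 0 0 * S j 1 1 + S j 0 0 * S i 1 1 - 2 * S i 0 1 * S j 0 1 := by
  rw [coeff_det_symmPencil_two d S hS]
  have hfilter : (univ : Finset (Fin K × Fin K)).filter (fun p => d p.1 + d p.2 = d i + d j) = {(i, j), (j, i)} := by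
    ext p
    simp only [Finset.mem_filter, Finset.mem_univ, true_and, Finset.mem_insert, Finset.mem_singleton]
    constructor
    · intro h
      rcases hsid p.1 p.2 i j h with ⟨h1, h2⟩ | ⟨h1, h2⟩
      · left; exact Prod.ext h1 h2
      · right; exact Prod.ext h1 h2
    · rintro (rfl | rfl)
      · rfl
      · exact Nat.add_comm _ _
  rw [hfilter, Finset.sum_pair (fun h => hij (Prod.mk.inj h).1)]
  ring

/-- on a Sidon support the diagonal coefficient at `2 d_i` is `det S_i = a_i c_i − b_i²` (`K`-letter form of `coeff_diag_of_sidon`). [bookkeeping] -/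
theorem coeff_diag_of_sidonK {K : ℕ} (d : Fin K → ℕ) (S : Fin K → Matrix (Fin 2) (Fin 2) F) (hS : ∀ l, (S l).IsSymm)
    (hsid : ∀ l₁ l₂ l₃ l₄ : Fin K, d l₁ + d l₂ = d l₃ + d l₄ → (l₁ = l₃ ∧ l₂ = l₄) ∨ (l₁ = l₄ ∧ l₂ = l₃)) (i : Fin K) :
    (Matrix.det (∑ l, ((X : F[X]) ^ d l) • (S l).map (C : F →+* F[X]))).coeff (d i + d i)
      = S i 0 0 * S i 1 1 - S i 0 1 * S i 0 1 := by
  rw [coeff_det_symmPencil_two d S hS]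
  have hfilter : (univ : Finset (Fin K × Fin K)).filter (fun p => d p.1 + d p.2 = d i + d i) = {(i, i)} := by
    ext p
    simp only [Finset.mem_filter, Finset.mem_univ, true_and, Finset.mem_singleton]
    constructor
    · intro h
      rcases hsid p.1 p.2 i i h with ⟨h1, h2⟩ | ⟨h1, h2⟩
      · exact Prod.ext h1 h2
      · exact Prod.ext h1 h2
    · rintro rfl; rfl
  rw [hfilter, Finset.sum_singleton]

/-! ## §2 The roof of two lines is concave along equal sums -/

/-- **outer ≤ inner for the minimum of two affine functions:** `A ≤ B`, `A ≤ C`, `A + D = B + C` ⇒ `h A + h D ≤ h B + h C` for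
`h t = min (p + q t) (p' + q' t)`. [elementary] -/
theorem min_affine_outer_le_inner (p q p' q' A B Cx D : ℝ) (hAB : A ≤ B) (hAC : A ≤ Cx) (hsum : A + D = B + Cx) :
    min (p + q * A) (p' + q' * A) + min (p + q * D) (p' + q' * D)
      ≤ min (p + q * B) (p' + q' * B) + min (p + q * Cx) (p' + q' * Cx) := by
  have hA1 := min_le_left (p + q * A) (p' + q' * A)
  have hA2 := min_le_right (p + q * A) (p' + q' * A)
  have hD1 := min_le_left (p + q * D) (p' + q' * D)
  have hD2 := min_le_right (p + q * D) (p' + q' * D)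
  have hDC : D - Cx = B - A := by linarith
  have hDB : D - B = Cx - A := by linarith
  rcases le_total (p + q * B) (p' + q' * B) with hB | hB <;>
    rcases le_total (p + q * Cx) (p' + q' * Cx) with hC | hC
  · rw [min_eq_left hB, min_eq_left hC]
    have e : q * A + q * D = q * B + q * Cx := by rw [← mul_add, ← mul_add, hsum]
    linarith
  · rw [min_eq_left hB, min_eq_right hC]
    rcases le_total q' q with hq | hq
    · have e : (q - q') * (B - A) = q * B - q * A - (q' * D - q' * Cx) := by linear_combination q' * hDC
      have hnn : 0 ≤ (q - q') * (B - A) := mul_nonneg (by linarith) (by linarith)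
      linarith
    · have e : (q' - q) * (Cx - A) = q' * Cx - q' * A - (q * D - q * B) := by linear_combination q * hDB
      have hnn : 0 ≤ (q' - q) * (Cx - A) := mul_nonneg (by linarith) (by linarith)
      linarith
  · rw [min_eq_right hB, min_eq_left hC]
    rcases le_total q q' with hq | hq
    · have e : (q' - q) * (B - A) = q' * B - q' * A - (q * D - q * Cx) := by linear_combination q * hDC
      have hnn : 0 ≤ (q' - q) * (B - A) := mul_nonneg (by linarith) (by linarith)
      linarith
    · have e : (q - q') * (Cx - A) = q * Cx - q * A - (q' * D - q' * B) := by linear_combination q' * hDB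
      have hnn : 0 ≤ (q - q') * (Cx - A) := mul_nonneg (by linarith) (by linarith)
      linarith
  · rw [min_eq_right hB, min_eq_right hC]
    have e : q' * A + q' * D = q' * B + q' * Cx := by rw [← mul_add, ← mul_add, hsum]
    linarith

/-! ## §3 The weak anti-Monge rearrangement -/

/-- **one swap of a non-inversion lowers the measure `Σ l·σ(l)` and does not lower the sum** (weak twin of `exists_swap_improve`, with
separate row slopes `dr` and column slopes `dc` so that non-principal minors are covered). [elementary] -/
theorem exists_swap_improve_le {n : ℕ} (x : Fin n → Fin n → ℝ) (dr dc : Fin n → ℕ) (hdr : StrictMono dr) (hdc : StrictMono dc)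
    (hconc : ∀ p₁ q₁ p₂ q₂ p₃ q₃ p₄ q₄ : Fin n,
      dr p₁ + dc q₁ + (dr p₄ + dc q₄) = dr p₂ + dc q₂ + (dr p₃ + dc q₃) →
      dr p₁ + dc q₁ < dr p₂ + dc q₂ → dr p₁ + dc q₁ < dr p₃ + dc q₃ → x p₁ q₁ + x p₄ q₄ ≤ x p₂ q₂ + x p₃ q₃)
    (σ : Equiv.Perm (Fin n)) (hσ : σ ≠ Fin.revPerm) :
    ∃ σ' : Equiv.Perm (Fin n), ∑ l : Fin n, l.val * (σ' l).val < ∑ l : Fin n, l.val * (σ l).val ∧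
      ∑ l, x l (σ l) ≤ ∑ l, x l (σ' l) := by
  -- a non-inversion i < j, σ i < σ j
  have hex : ∃ i j : Fin n, i < j ∧ σ i < σ j := by
    by_contra hno
    push Not at hno
    exact hσ (eq_revPerm_of_forall_lt σ fun i j hij => lt_of_le_of_ne (hno i j hij) fun heq => (ne_of_lt hij) (σ.injective heq.symm))
  obtain ⟨i, j, hij, hσij⟩ := hex
  have hne : i ≠ j := ne_of_lt hij
  refine ⟨(Equiv.swap i j).trans σ, ?_, ?_⟩
  · have hsplit : ∀ g : Fin n → ℕ, ∑ l : Fin n, g l = g i + (g j + ∑ l ∈ (univ.erase i).erase j, g l) := by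
      intro g
      rw [← Finset.add_sum_erase _ g (Finset.mem_univ i), ← Finset.add_sum_erase _ g (Finset.mem_erase.2 ⟨hne.symm, Finset.mem_univ j⟩)]
    rw [hsplit (fun l : Fin n => l.val * (((Equiv.swap i j).trans σ) l).val), hsplit (fun l : Fin n => l.val * (σ l).val)]
    have hrest : ∑ l ∈ (univ.erase i).erase j, l.val * (((Equiv.swap i j).trans σ) l).val
        = ∑ l ∈ (univ.erase i).erase j, l.val * (σ l).val := by
      refine Finset.sum_congr rfl fun l hl => ?_
      have hlj : l ≠ j := (Finset.mem_erase.1 hl).1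
      have hli : l ≠ i := (Finset.mem_erase.1 (Finset.mem_erase.1 hl).2).1
      simp only [Equiv.trans_apply, Equiv.swap_apply_of_ne_of_ne hli hlj]
    rw [hrest]
    simp only [Equiv.trans_apply, Equiv.swap_apply_left, Equiv.swap_apply_right]
    have h1 : (i : ℕ) < j := Fin.lt_def.1 hij
    have h2 : (σ i : ℕ) < σ j := Fin.lt_def.1 hσij
    nlinarith
  · have hsplit : ∀ g : Fin n → ℝ, ∑ l : Fin n, g l = g i + (g j + ∑ l ∈ (univ.erase i).erase j, g l) := by
      intro g
      rw [← Finset.add_sum_erase _ g (Finset.mem_univ i), ← Finset.add_sum_erase _ g (Finset.mem_erase.2 ⟨hne.symm, Finset.mem_univ j⟩)]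
    rw [hsplit (fun l => x l (((Equiv.swap i j).trans σ) l)), hsplit (fun l => x l (σ l))]
    have hrest : ∑ l ∈ (univ.erase i).erase j, x l (((Equiv.swap i j).trans σ) l) = ∑ l ∈ (univ.erase i).erase j, x l (σ l) := by
      refine Finset.sum_congr rfl fun l hl => ?_
      have hlj : l ≠ j := (Finset.mem_erase.1 hl).1
      have hli : l ≠ i := (Finset.mem_erase.1 (Finset.mem_erase.1 hl).2).1
      simp only [Equiv.trans_apply, Equiv.swap_apply_of_ne_of_ne hli hlj]
    rw [hrest]
    simp only [Equiv.trans_apply, Equiv.swap_apply_left, Equiv.swap_apply_right]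
    have key := hconc i (σ i) i (σ j) j (σ i) j (σ j) (by ring) (Nat.add_lt_add_left (hdc hσij) _)
      (Nat.add_lt_add_right (hdr hij) _)
    linarith

/-- **THE WEAK ANTI-MONGE REARRANGEMENT:** under weak concavity along equal slope-sums (row slopes `dr`, column slopes `dc`) the reversal
maximises `σ ↦ Σ_l x l (σ l)` (weak, two-slope twin of `sum_perm_lt_sum_rev`). [elementary; induction on the measure `Σ l·σ(l)`] -/
theorem sum_perm_le_sum_rev {n : ℕ} (x : Fin n → Fin n → ℝ) (dr dc : Fin n → ℕ) (hdr : StrictMono dr) (hdc : StrictMono dc)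
    (hconc : ∀ p₁ q₁ p₂ q₂ p₃ q₃ p₄ q₄ : Fin n,
      dr p₁ + dc q₁ + (dr p₄ + dc q₄) = dr p₂ + dc q₂ + (dr p₃ + dc q₃) →
      dr p₁ + dc q₁ < dr p₂ + dc q₂ → dr p₁ + dc q₁ < dr p₃ + dc q₃ → x p₁ q₁ + x p₄ q₄ ≤ x p₂ q₂ + x p₃ q₃) :
    ∀ (N : ℕ) (σ : Equiv.Perm (Fin n)), ∑ l : Fin n, l.val * (σ l).val ≤ N →
      ∑ l, x l (σ l) ≤ ∑ l, x l (Fin.revPerm l) := by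
  intro N
  induction N with
  | zero =>
    intro σ hN
    by_cases hσ : σ = Fin.revPerm
    · rw [hσ]
    · obtain ⟨σ', hμ, -⟩ := exists_swap_improve_le x dr dc hdr hdc hconc σ hσ
      omega
  | succ N ih =>
    intro σ hN
    by_cases hσ : σ = Fin.revPerm
    · rw [hσ]
    · obtain ⟨σ', hμ, hsum⟩ := exists_swap_improve_le x dr dc hdr hdc hconc σ hσ
      exact hsum.trans (ih σ' (by omega))

/-! ## §4 Nested pairs are never both dominant -/

/-- **NESTED PAIRS ARE NEVER BOTH DOMINANT.**  For a symmetric `2 × 2` lacunary pencil on a Sidon support and four letters with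
`d a < d b < d c < d e`, the pair exponents `d a + d e` (outer) and `d b + d c` (inner) are not both dominant for any non-archimedean `v`.
[the four-letter Gram obstruction with the roof of the two dominance lines] -/
theorem not_nested_dominant_of_sidon (v : AbsoluteValue F ℝ) (hv : IsNonarchimedean v) {K : ℕ} (d : Fin K → ℕ)
    (S : Fin K → Matrix (Fin 2) (Fin 2) F) (hS : ∀ l, (S l).IsSymm)
    (hsid : ∀ l₁ l₂ l₃ l₄ : Fin K, d l₁ + d l₂ = d l₃ + d l₄ → (l₁ = l₃ ∧ l₂ = l₄) ∨ (l₁ = l₄ ∧ l₂ = l₃))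
    {a b c e : Fin K} (hab : d a < d b) (hbc : d b < d c) (hce : d c < d e)
    (hB : (d a + d e) ∈ (Matrix.det (∑ l, ((X : F[X]) ^ d l) • (S l).map (C : F →+* F[X]))).support ∧
      ∃ r : ℝ, 0 < r ∧ ∀ E' ∈ (Matrix.det (∑ l, ((X : F[X]) ^ d l) • (S l).map (C : F →+* F[X]))).support, E' ≠ d a + d e →
        v ((Matrix.det (∑ l, ((X : F[X]) ^ d l) • (S l).map (C : F →+* F[X]))).coeff E') * r ^ E'
          < v ((Matrix.det (∑ l, ((X : F[X]) ^ d l) • (S l).map (C : F →+* F[X]))).coeff (d a + d e)) * r ^ (d a + d e))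
    (hC : (d b + d c) ∈ (Matrix.det (∑ l, ((X : F[X]) ^ d l) • (S l).map (C : F →+* F[X]))).support ∧
      ∃ r : ℝ, 0 < r ∧ ∀ E' ∈ (Matrix.det (∑ l, ((X : F[X]) ^ d l) • (S l).map (C : F →+* F[X]))).support, E' ≠ d b + d c →
        v ((Matrix.det (∑ l, ((X : F[X]) ^ d l) • (S l).map (C : F →+* F[X]))).coeff E') * r ^ E'
          < v ((Matrix.det (∑ l, ((X : F[X]) ^ d l) • (S l).map (C : F →+* F[X]))).coeff (d b + d c)) * r ^ (d b + d c)) :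
    False := by
  set f : F[X] := Matrix.det (∑ l, ((X : F[X]) ^ d l) • (S l).map (C : F →+* F[X])) with hf
  -- the four letters as a strictly increasing map
  set ι : Fin 4 → Fin K := ![a, b, c, e] with hι
  have hι0 : ι 0 = a := rfl
  have hι1 : ι 1 = b := rfl
  have hι2 : ι 2 = c := rfl
  have hι3 : ι 3 = e := rfl
  have hmono : StrictMono (d ∘ ι) := by
    refine Fin.strictMono_iff_lt_succ.2 fun i => ?_
    fin_cases i
    · exact hab
    · exact hbc
    · exact hce
  have hιinj : Function.Injective ι := fun i j hij => hmono.injective (by simp only [Function.comp_apply, hij])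
  set B : ℕ := d a + d e with hBdef
  set Cx : ℕ := d b + d c with hCdef
  -- Sidon bookkeeping: which pairs of the four letters have sum `B` / `Cx`
  have hsumB : ∀ i j : Fin 4, d (ι i) + d (ι j) = B → i = Fin.revPerm j := by
    intro i j h
    rw [hBdef, ← hι0, ← hι3] at h
    rcases hsid _ _ _ _ h with ⟨h1, h2⟩ | ⟨h1, h2⟩
    · have := hιinj h1; have := hιinj h2; subst i; subst j; rfl
    · have := hιinj h1; have := hιinj h2; subst i; subst j; rfl
  have hsumC : ∀ i j : Fin 4, d (ι i) + d (ι j) = Cx → i = Fin.revPerm j := by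
    intro i j h
    rw [hCdef, ← hι1, ← hι2] at h
    rcases hsid _ _ _ _ h with ⟨h1, h2⟩ | ⟨h1, h2⟩
    · have := hιinj h1; have := hιinj h2; subst i; subst j; rfl
    · have := hιinj h1; have := hιinj h2; subst i; subst j; rfl
  have hBC : B ≠ Cx := by
    intro h
    rcases hsid a e b c h with ⟨h1, -⟩ | ⟨h1, -⟩
    · rw [h1] at hab; exact lt_irrefl _ hab
    · rw [h1] at hab; exact lt_irrefl _ (hab.trans hbc)
  have hrevB : ∀ l : Fin 4, d (ι (Fin.revPerm l)) + d (ι l) = B ∨ d (ι (Fin.revPerm l)) + d (ι l) = Cx := by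
    intro l
    fin_cases l
    · left; show d (ι 3) + d (ι 0) = B; rw [hι3, hι0, hBdef, Nat.add_comm]
    · right; show d (ι 2) + d (ι 1) = Cx; rw [hι2, hι1, hCdef, Nat.add_comm]
    · right; show d (ι 1) + d (ι 2) = Cx; rw [hι1, hι2]
    · left; show d (ι 0) + d (ι 3) = B; rw [hι0, hι3]
  -- the two dominance lines and their roof
  set ℓ : ℕ → ℝ := fun E => Real.log (v (f.coeff E)) with hℓ
  obtain ⟨sB, hsB⟩ := (exists_dominant_iff_exists_slope v f hB.1).1 hB.2
  obtain ⟨sC, hsC⟩ := (exists_dominant_iff_exists_slope v f hC.1).1 hC.2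
  set h : ℝ → ℝ := fun t => min (ℓ B + (B : ℝ) * sB + (-sB) * t) (ℓ Cx + (Cx : ℝ) * sC + (-sC) * t) with hh
  have hmaj : ∀ E ∈ f.support, ℓ E ≤ h E := by
    intro E hE
    refine le_min ?_ ?_
    · by_cases hEB : E = B
      · rw [hEB]; linarith
      · have := hsB E hE hEB; linarith
    · by_cases hEC : E = Cx
      · rw [hEC]; linarith
      · have := hsC E hE hEC; linarith
  have hmaj_lt : ∀ E ∈ f.support, E ≠ B → E ≠ Cx → ℓ E < h E := by
    intro E hE hEB hEC
    refine lt_min ?_ ?_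
    · have := hsB E hE hEB; linarith
    · have := hsC E hE hEC; linarith
  have hhB : h B = ℓ B := by
    refine le_antisymm ((min_le_left _ _).trans (by linarith)) (hmaj B hB.1)
  have hhC : h Cx = ℓ Cx := by
    refine le_antisymm ((min_le_right _ _).trans (by linarith)) (hmaj Cx hC.1)
  -- the Gram matrix of the four letters
  set G : Matrix (Fin 4) (Fin 4) F :=
    Matrix.of fun i j : Fin 4 => S (ι i) 0 0 * S (ι j) 1 1 + S (ι j) 0 0 * S (ι i) 1 1 - 2 * S (ι i) 0 1 * S (ι j) 0 1 with hG
  have hdet : G.det = 0 := det_gram_polarDet_eq_zero (fun i => S (ι i) 0 0) (fun i => S (ι i) 0 1) (fun i => S (ι i) 1 1)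
  have hGoff : ∀ i j, i ≠ j → G i j = f.coeff (d (ι i) + d (ι j)) := by
    intro i j hij
    rw [hG, Matrix.of_apply, hf, coeff_offdiag_of_sidonK d S hS hsid (fun h' => hij (hιinj h'))]
  have hGdiag : ∀ i, G i i = 2 * f.coeff (d (ι i) + d (ι i)) := by
    intro i
    rw [hG, Matrix.of_apply, hf, coeff_diag_of_sidonK d S hS hsid (ι i)]
    ring
  -- every nonzero entry sits under the roof
  have hent : ∀ i j, G i j ≠ 0 → (d (ι i) + d (ι j)) ∈ f.support ∧ Real.log (v (G i j)) ≤ ℓ (d (ι i) + d (ι j)) := by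
    intro i j hne
    by_cases hij : i = j
    · subst hij
      rw [hGdiag] at hne ⊢
      have hc : f.coeff (d (ι i) + d (ι i)) ≠ 0 := fun h0 => hne (by rw [h0, mul_zero])
      have h2 : (2 : F) ≠ 0 := fun h0 => hne (by rw [h0, zero_mul])
      refine ⟨Polynomial.mem_support_iff.2 hc, ?_⟩
      rw [map_mul, Real.log_mul (v.ne_zero h2) (v.ne_zero hc)]
      have : Real.log (v 2) ≤ 0 := Real.log_nonpos (v.nonneg _) (abv_two_le_one v hv)
      show Real.log (v 2) + Real.log (v (f.coeff (d (ι i) + d (ι i)))) ≤ ℓ (d (ι i) + d (ι i))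
      simp only [hℓ]
      linarith
    · rw [hGoff i j hij] at hne ⊢
      exact ⟨Polynomial.mem_support_iff.2 hne, le_rfl⟩
  -- the roof table and its weak concavity along equal sums
  set x : Fin 4 → Fin 4 → ℝ := fun i j => h ((d (ι i) + d (ι j) : ℕ) : ℝ) with hx
  have hxsymm : ∀ i j, x i j = x j i := fun i j => by simp only [hx, Nat.add_comm]
  have hconc : ∀ p₁ q₁ p₂ q₂ p₃ q₃ p₄ q₄ : Fin 4,
      (d ∘ ι) p₁ + (d ∘ ι) q₁ + ((d ∘ ι) p₄ + (d ∘ ι) q₄) = (d ∘ ι) p₂ + (d ∘ ι) q₂ + ((d ∘ ι) p₃ + (d ∘ ι) q₃) →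
      (d ∘ ι) p₁ + (d ∘ ι) q₁ < (d ∘ ι) p₂ + (d ∘ ι) q₂ → (d ∘ ι) p₁ + (d ∘ ι) q₁ < (d ∘ ι) p₃ + (d ∘ ι) q₃ →
      x p₁ q₁ + x p₄ q₄ ≤ x p₂ q₂ + x p₃ q₃ := by
    intro p₁ q₁ p₂ q₂ p₃ q₃ p₄ q₄ hsum h12 h13
    simp only [Function.comp_apply] at hsum h12 h13
    simp only [hx, hh]
    refine min_affine_outer_le_inner _ _ _ _ _ _ _ _ ?_ ?_ ?_
    · exact_mod_cast h12.le
    · exact_mod_cast h13.le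
    · exact_mod_cast hsum
  -- Leibniz terms
  have hterm : ∀ σ : Equiv.Perm (Fin 4), v (Equiv.Perm.sign σ • ∏ l, G (σ l) l) = ∏ l, v (G (σ l) l) := by
    intro σ
    rcases Int.units_eq_one_or (Equiv.Perm.sign σ) with h1 | h1
    · rw [h1, one_smul, map_prod]
    · rw [h1, Units.neg_smul, one_smul, AbsoluteValue.map_neg, map_prod]
  have hrev_ne : ∀ l : Fin 4, Fin.revPerm l ≠ l := by
    intro l h0
    have := congrArg Fin.val h0
    rw [Fin.revPerm_apply, Fin.val_rev] at this
    omega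
  -- the reversal term is `exp` of its roof sum
  have hxrev : ∀ l : Fin 4, x (Fin.revPerm l) l = ℓ (d (ι (Fin.revPerm l)) + d (ι l)) := by
    intro l
    simp only [hx]
    rcases hrevB l with h0 | h0
    · rw [h0, hhB]
    · rw [h0, hhC]
  have hrev_supp : ∀ l : Fin 4, (d (ι (Fin.revPerm l)) + d (ι l)) ∈ f.support := by
    intro l
    rcases hrevB l with h0 | h0
    · rw [h0]; exact hB.1
    · rw [h0]; exact hC.1
  have heq : ∏ l, v (G (Fin.revPerm l) l) = Real.exp (∑ l, x (Fin.revPerm l) l) := by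
    rw [Real.exp_sum]
    refine Finset.prod_congr rfl fun l _ => ?_
    rw [hxrev, hGoff _ _ (hrev_ne l), hℓ]
    simp only []
    rw [Real.exp_log (v.pos (Polynomial.mem_support_iff.1 (hrev_supp l)))]
  -- every other term is strictly smaller
  have hmax : ∀ σ ∈ (univ : Finset (Equiv.Perm (Fin 4))), σ ≠ Fin.revPerm →
      v (Equiv.Perm.sign σ • ∏ l, G (σ l) l)
        < v (Equiv.Perm.sign (Fin.revPerm : Equiv.Perm (Fin 4)) • ∏ l, G ((Fin.revPerm : Equiv.Perm (Fin 4)) l) l) := by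
    intro σ _ hσ
    rw [hterm, hterm, heq]
    by_cases hz : ∃ l, G (σ l) l = 0
    · obtain ⟨l, hl⟩ := hz
      rw [Finset.prod_eq_zero (Finset.mem_univ l) (by rw [hl, map_zero])]
      exact Real.exp_pos _
    push Not at hz
    have hprod : ∏ l, v (G (σ l) l) = Real.exp (∑ l, Real.log (v (G (σ l) l))) := by
      rw [Real.exp_sum]
      exact Finset.prod_congr rfl fun l _ => (Real.exp_log (v.pos (hz l))).symm
    rw [hprod]
    refine Real.exp_lt_exp.2 ?_
    have hle_l : ∀ l, Real.log (v (G (σ l) l)) ≤ x (σ l) l := fun l =>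
      (hent _ _ (hz l)).2.trans (hmaj _ (hent _ _ (hz l)).1)
    obtain ⟨l₀, hl₀⟩ : ∃ l, σ l ≠ Fin.revPerm l := by
      by_contra hno
      push Not at hno
      exact hσ (Equiv.ext hno)
    have hneB : d (ι (σ l₀)) + d (ι l₀) ≠ B := fun h0 => hl₀ (hsumB (σ l₀) l₀ h0)
    have hneC : d (ι (σ l₀)) + d (ι l₀) ≠ Cx := fun h0 => hl₀ (hsumC (σ l₀) l₀ h0)
    have hlt_l : Real.log (v (G (σ l₀) l₀)) < x (σ l₀) l₀ :=
      (hent _ _ (hz l₀)).2.trans_lt (hmaj_lt _ (hent _ _ (hz l₀)).1 hneB hneC)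
    calc ∑ l, Real.log (v (G (σ l) l)) < ∑ l, x (σ l) l :=
          Finset.sum_lt_sum (fun l _ => hle_l l) ⟨l₀, Finset.mem_univ _, hlt_l⟩
      _ = ∑ l, x l (σ l) := Finset.sum_congr rfl fun l _ => hxsymm _ _
      _ ≤ ∑ l, x l (Fin.revPerm l) := sum_perm_le_sum_rev x (d ∘ ι) (d ∘ ι) hmono hmono hconc _ σ le_rfl
      _ = ∑ l, x (Fin.revPerm l) l := Finset.sum_congr rfl fun l _ => hxsymm _ _
  have hsum := abv_sum_eq_of_unique_max v hv (univ : Finset (Equiv.Perm (Fin 4)))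
    (fun σ => Equiv.Perm.sign σ • ∏ l, G (σ l) l) (Finset.mem_univ (Fin.revPerm : Equiv.Perm (Fin 4))) hmax
  rw [← Matrix.det_apply, hdet, map_zero, hterm, heq] at hsum
  exact absurd hsum (ne_of_lt (Real.exp_pos _))

end Summit.ValiantsHypothesis.ValiantsHypothesis.Theorems.KPlusLogSqLaw.ValDoor
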